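import Summits.BirchSwinnertonDyer.BirchSwinnertonDyer.Theorems.GenusKolyvaginAtTwoTorsionCellSELNegTwistMember
import Summits.BirchSwinnertonDyer.BirchSwinnertonDyer.Theorems.GenusKolyvaginAtTwoTorsionCellD0NegPrimeTwistClasses
import HarnessLib

/-!
# SEL (iso-class Selmer pair law), C1-N: the parametrised pairs `(B₁X₁∏_{A₁}, B₂X₂∏_{A₂})` are Selmer classes

Crux R″ `RankOneTwoTorsionResidualAtTwo` (stmt-27478), LINE 49 «full_vertex», SUPPORT stub SEL
`IsoClassSelmerPairLawAtTwo`, the `C₁` half (LEAD memo `Cruxes/…/Lines/torsion_cell_full_vertex_SEL_C1_road_g36.md`, §3,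
the map `Ψ`).  Setting of part C1-J.  A BASE PAIR `(B₁, B₂)` (even valuations off `S`, constant residues `(c₁, c₂)` on `Q`,
residues `(ρ₁, ρ₂)` at `p₀`, signs `(s₁, s₂)`; in the application `Bᵢ = wᵢ^σ tᵢ(τ)`), TWISTING FACTORS `X₁, X₂ ∈ {1, −p₀}`
with `p₀`-parities `(γ₁, γ₂)`, and supports `A₁, A₂ ⊆ Q` such that `c_E(B₁∏_{A₁}, B₂∏_{A₂})` is relaxed at `S`:
**`twist_mem_selmerGroup_param`** — the raw rows (parts C1-F/C1-J) in these bits imply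
`c_{E^{(d)}}((B₁∏_{A₁})X₁, (B₂∏_{A₂})X₂) ∈ Sel⁽²⁾(E^{(d)}/ℚ)` (bit bookkeeping of the product + `twist_mem_selmerGroup_of_rawRows`).

Everything is proved; no LINE 49 statement is restated; BSD is not advanced by this file alone.

## References

* [SilvermanAEC2009] J. H. Silverman, *The Arithmetic of Elliptic Curves*, 2nd ed., Prop. X.1.4, Prop. X.4.9.
* [Kane2013SelmerTwists] D. M. Kane, Algebra Number Theory 7 (2013), §2.
-/

noncomputable section

open scoped Classical

namespace Summit.BirchSwinnertonDyer.BirchSwinnertonDyer.Theorems.GenusKolyvaginAtTwo.TorsionCellSEL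

open WeierstrassCurve WeierstrassCurve.Affine WeierstrassCurve.Affine.Point
open Literature.NumberTheory.GaloisRepresentations Literature.NumberTheory.EllipticCurves Field
open Literature.NumberTheory.EllipticCurves.TwoDescentLocal
open Literature.NumberTheory.EllipticCurves.KramerTwoDescent
open Literature.NumberTheory.QuadraticForms
open Summit.BirchSwinnertonDyer.BirchSwinnertonDyer.Theorems.GenusKolyvaginAtTwo.TorsionCellD0
open IsDedekindDomain NumberField Rat.HeightOneSpectrum

variable (E : WeierstrassCurve ℚ) [E.IsElliptic] {e₁ e₂ e₃ : ℚ} (S Q : Finset ℕ) {p₀ : ℕ} [hp₀ : Fact p₀.Prime]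

/-- **THE PARAMETRISED PAIRS ARE SELMER** (see the module docstring). [cite: SilvermanAEC2009, Prop. X.1.4, Prop. X.4.9]
[cite: Kane2013SelmerTwists, §2] -/
theorem twist_mem_selmerGroup_param (h : E.toAffine.SplitTwoTorsion e₁ e₂ e₃) (h2S : 2 ∈ S)
    (h12 : e₁ < e₂) (h23 : e₂ < e₃)
    (hgood : ∀ ℓ : ℕ, (hℓ : ℓ.Prime) → ℓ ∉ S → haveI : Fact ℓ.Prime := ⟨hℓ⟩;
      padicValRat ℓ (e₁ - e₂) = 0 ∧ padicValRat ℓ (e₁ - e₃) = 0 ∧ padicValRat ℓ (e₂ - e₃) = 0)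
    (hN : ∀ ℓ : ℕ, ℓ.Prime → ℓ ∉ S → ¬ ℓ ∣ E.conductorNorm ℤ)
    (hQ : ∀ q ∈ Q, q.Prime) (hQS : ∀ q ∈ Q, q ∉ S) (hQ4 : ∀ q ∈ Q, q % 4 = 3) (hk : Even Q.card)
    (hiso8 : ∀ q ∈ Q, ∀ q' ∈ Q, q % 8 = q' % 8)
    (hisoS : ∀ q ∈ Q, ∀ q' ∈ Q, ∀ ℓ ∈ S, (hℓ : ℓ.Prime) → ℓ ≠ 2 → haveI : Fact ℓ.Prime := ⟨hℓ⟩;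
      legendreSym ℓ ((q : ℤ) * q') = 1)
    (hadm : ∀ q ∈ Q, (hq : q.Prime) → haveI : Fact q.Prime := ⟨hq⟩;
      qrBit q ((e₁ - e₂) * (e₁ - e₃)) = 1 ∧ qrBit q ((e₂ - e₁) * (e₂ - e₃)) = 1)
    {ε : ZMod 2} (hε : ∀ q ∈ Q, (hq : q.Prime) → haveI : Fact q.Prime := ⟨hq⟩; qrBit q (e₂ - e₁) = ε)
    (hp₀S : p₀ ∉ S) (hp₀Q : p₀ ∉ Q) (hp8 : p₀ % 8 = 7)
    (hsplitp : ∀ ℓ ∈ S, (hℓ : ℓ.Prime) → ℓ ≠ 2 → haveI : Fact ℓ.Prime := ⟨hℓ⟩; legendreSym ℓ (-(p₀ : ℤ)) = 1)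
    (hres₀ : qrBit p₀ (e₂ - e₁) = 0 ∧ qrBit p₀ (e₁ - e₂) = 1 ∧
      qrBit p₀ ((e₁ - e₂) * (e₁ - e₃)) = 0 ∧ qrBit p₀ ((e₂ - e₁) * (e₂ - e₃)) = 1)
    {d : ℚ} (hd : d = -(p₀ : ℚ) * ∏ q ∈ Q, (q : ℚ)) [(E.quadraticTwist d).IsElliptic]
    (B₁ B₂ X₁ X₂ : ℚˣ) {A₁ A₂ : Finset ℕ} (hA₁ : A₁ ⊆ Q) (hA₂ : A₂ ⊆ Q)
    (hp₁ : ∏ i ∈ A₁, (i : ℚ) ≠ 0) (hp₂ : ∏ i ∈ A₂, (i : ℚ) ≠ 0)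
    {γ₁ γ₂ c₁ c₂ ρ₁ ρ₂ s₁ s₂ : ZMod 2}
    (hBpar : ∀ ℓ : ℕ, (hℓ : ℓ.Prime) → ℓ ∉ S → haveI : Fact ℓ.Prime := ⟨hℓ⟩;
      parityBit ℓ (B₁ : ℚ) = 0 ∧ parityBit ℓ (B₂ : ℚ) = 0)
    (hBQ : ∀ j ∈ Q, (hj : j.Prime) → haveI : Fact j.Prime := ⟨hj⟩; qrBit j (B₁ : ℚ) = c₁ ∧ qrBit j (B₂ : ℚ) = c₂)
    (hBp : qrBit p₀ (B₁ : ℚ) = ρ₁ ∧ qrBit p₀ (B₂ : ℚ) = ρ₂) (hBs : signBit (B₁ : ℚ) = s₁ ∧ signBit (B₂ : ℚ) = s₂)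
    (hBrel : ∀ v : HeightOneSpectrum (𝓞 ℚ), natGenerator v ∈ S →
      E.twoDescentClass h (B₁ * Units.mk0 _ hp₁) (B₂ * Units.mk0 _ hp₂) ∈ selmerLocalKer E (v.adicCompletion ℚ) 2)
    (hXval : ((X₁ : ℚ) = 1 ∨ (X₁ : ℚ) = -(p₀ : ℚ)) ∧ ((X₂ : ℚ) = 1 ∨ (X₂ : ℚ) = -(p₀ : ℚ)))
    (hXpar : ∀ ℓ : ℕ, (hℓ : ℓ.Prime) → ℓ ≠ p₀ → haveI : Fact ℓ.Prime := ⟨hℓ⟩;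
      parityBit ℓ (X₁ : ℚ) = 0 ∧ parityBit ℓ (X₂ : ℚ) = 0)
    (hXp : parityBit p₀ (X₁ : ℚ) = γ₁ ∧ parityBit p₀ (X₂ : ℚ) = γ₂)
    (hXQ : ∀ j ∈ Q, (hj : j.Prime) → haveI : Fact j.Prime := ⟨hj⟩;
      qrBit j (X₁ : ℚ) = γ₁ * (if jacobiSym (-(p₀ : ℤ)) j = -1 then (1 : ZMod 2) else 0) ∧
        qrBit j (X₂ : ℚ) = γ₂ * (if jacobiSym (-(p₀ : ℤ)) j = -1 then (1 : ZMod 2) else 0))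
    (hXp₀ : qrBit p₀ (X₁ : ℚ) = γ₁ ∧ qrBit p₀ (X₂ : ℚ) = γ₂) (hXs : signBit (X₁ : ℚ) = γ₁ ∧ signBit (X₂ : ℚ) = γ₂)
    (hrows : ∀ j ∈ Q,
      ((∑ i ∈ Q.erase j, (if jacobiSym (-(i : ℤ)) j = -1 then (1 : ZMod 2) else 0) * (if i ∈ A₁ then 1 else 0)) +
          ((∑ i ∈ Q.erase j, (if jacobiSym (-(i : ℤ)) j = -1 then (1 : ZMod 2) else 0)) +
            (if jacobiSym (-(p₀ : ℤ)) j = -1 then (1 : ZMod 2) else 0) + ε) * (if j ∈ A₁ then 1 else 0) +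
          (if j ∈ A₂ then 1 else 0) =
        c₁ + γ₁ * (if jacobiSym (-(p₀ : ℤ)) j = -1 then (1 : ZMod 2) else 0) + (A₁.card : ZMod 2)) ∧
      ((∑ i ∈ Q.erase j, (if jacobiSym (-(i : ℤ)) j = -1 then (1 : ZMod 2) else 0) * (if i ∈ A₂ then 1 else 0)) +
          ((∑ i ∈ Q.erase j, (if jacobiSym (-(i : ℤ)) j = -1 then (1 : ZMod 2) else 0)) +
            (if jacobiSym (-(p₀ : ℤ)) j = -1 then (1 : ZMod 2) else 0) + ε + 1) * (if j ∈ A₂ then 1 else 0) +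
          (if j ∈ A₁ then 1 else 0) =
        c₂ + γ₂ * (if jacobiSym (-(p₀ : ℤ)) j = -1 then (1 : ZMod 2) else 0) + (A₂.card : ZMod 2)))
    (hPa : ρ₁ + ∑ i ∈ Q, (if jacobiSym (-(p₀ : ℤ)) i = -1 then (1 : ZMod 2) else 0) * (if i ∈ A₁ then 1 else 0) +
      γ₁ * ∑ i ∈ Q, (if jacobiSym (-(p₀ : ℤ)) i = -1 then (1 : ZMod 2) else 0) = 0)
    (hPb : ρ₂ + γ₂ + ∑ i ∈ Q, (if jacobiSym (-(p₀ : ℤ)) i = -1 then (1 : ZMod 2) else 0) * (if i ∈ A₂ then 1 else 0) +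
      γ₁ + γ₂ * ∑ i ∈ Q, (if jacobiSym (-(p₀ : ℤ)) i = -1 then (1 : ZMod 2) else 0) = 0)
    (hinf : s₁ + γ₁ = s₂ + γ₂) :
    (E.quadraticTwist d).twoDescentClass (h.quadraticTwist d) ((B₁ * Units.mk0 _ hp₁) * X₁) ((B₂ * Units.mk0 _ hp₂) * X₂) ∈
      selmerGroup (E.quadraticTwist d) 2 := by
  have hp4 : p₀ % 4 = 3 := by omega
  have hA₁p : ∀ i ∈ A₁, i.Prime := fun i hi => hQ i (hA₁ hi)
  have hA₂p : ∀ i ∈ A₂, i.Prime := fun i hi => hQ i (hA₂ hi)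
  have hposP₁ : (0 : ℚ) < ∏ i ∈ A₁, (i : ℚ) := Finset.prod_pos fun i hi => by exact_mod_cast (hA₁p i hi).pos
  have hposP₂ : (0 : ℚ) < ∏ i ∈ A₂, (i : ℚ) := Finset.prod_pos fun i hi => by exact_mod_cast (hA₂p i hi).pos
  -- twisting factors are squares at the places of `S`
  have hsqX : ∀ {X : ℚˣ}, ((X : ℚ) = 1 ∨ (X : ℚ) = -(p₀ : ℚ)) → ∀ v : HeightOneSpectrum (𝓞 ℚ), natGenerator v ∈ S →
      IsSquare (algebraMap ℚ (v.adicCompletion ℚ) (X : ℚ)) := by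
    intro X hX v hvS
    rcases hX with e | e
    · rw [e, map_one]; exact IsSquare.one
    · rw [e]
      by_cases hv2 : (primesEquiv v : ℕ) = 2
      · exact isSquare_neg_prime_adicCompletion_two (p := p₀) hp8 v hv2
      · haveI : Fact (primesEquiv v : ℕ).Prime := ⟨(primesEquiv v).2⟩
        have hℓp : (primesEquiv v : ℕ) ≠ p₀ := fun e' => hp₀S (e' ▸ hvS)
        exact isSquare_neg_prime_adicCompletion_odd (p := p₀) v rfl hv2 hℓp (hsplitp _ hvS (primesEquiv v).2 hv2)
  -- relaxedness of the product
  have hrel : ∀ v : HeightOneSpectrum (𝓞 ℚ), natGenerator v ∈ S →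
      E.twoDescentClass h ((B₁ * Units.mk0 _ hp₁) * X₁) ((B₂ * Units.mk0 _ hp₂) * X₂) ∈ selmerLocalKer E (v.adicCompletion ℚ) 2 := by
    intro v hvS
    rw [twoDescentClass_mul]
    exact add_mem (hBrel v hvS) (twoDescentClass_mem_selmerLocalKer_of_isSquare E h _
      (charZero_of_injective_algebraMap (algebraMap ℚ _).injective) _ _ (hsqX hXval.1 v hvS) (hsqX hXval.2 v hvS))
  -- bits of the products
  have hparP : ∀ (ℓ : ℕ) [Fact ℓ.Prime], parityBit ℓ (∏ i ∈ A₁, (i : ℚ)) = (if ℓ ∈ A₁ then 1 else 0) ∧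
      parityBit ℓ (∏ i ∈ A₂, (i : ℚ)) = (if ℓ ∈ A₂ then 1 else 0) :=
    fun ℓ _ => ⟨parityBit_prod_primes hA₁p ℓ, parityBit_prod_primes hA₂p ℓ⟩
  have hsP₁ : signBit (∏ i ∈ A₁, (i : ℚ)) = 0 := (signBit_eq_zero_iff hp₁).mpr hposP₁
  have hsP₂ : signBit (∏ i ∈ A₂, (i : ℚ)) = 0 := (signBit_eq_zero_iff hp₂).mpr hposP₂
  have hqP : qrBit p₀ (∏ i ∈ A₁, (i : ℚ)) = ∑ i ∈ Q, (if jacobiSym (-(p₀ : ℤ)) i = -1 then (1 : ZMod 2) else 0) * (if i ∈ A₁ then 1 else 0) ∧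
      qrBit p₀ (∏ i ∈ A₂, (i : ℚ)) = ∑ i ∈ Q, (if jacobiSym (-(p₀ : ℤ)) i = -1 then (1 : ZMod 2) else 0) * (if i ∈ A₂ then 1 else 0) := by
    have key : ∀ {A : Finset ℕ}, A ⊆ Q → qrBit p₀ (∏ i ∈ A, (i : ℚ)) =
        ∑ i ∈ Q, (if jacobiSym (-(p₀ : ℤ)) i = -1 then (1 : ZMod 2) else 0) * (if i ∈ A then 1 else 0) := by
      intro A hA
      rw [qrBit_prod_natCast A (fun i hi => (hQ i (hA hi)).ne_zero)]
      have hset : Q.filter (· ∈ A) = A := by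
        ext i; simp only [Finset.mem_filter]; exact ⟨fun h => h.2, fun h => ⟨hA h, h⟩⟩
      symm
      rw [Finset.sum_congr rfl fun i _ => mul_boole _ _, ← Finset.sum_filter, hset]
      refine Finset.sum_congr rfl fun i hi => ?_
      have hip : i ≠ p₀ := fun e => hp₀Q (e ▸ hA hi)
      exact (qrBit_natCast_prime_eq_jacobiBit (hQ i (hA hi)) hip hp4 (hQ4 i (hA hi))).symm
    exact ⟨key hA₁, key hA₂⟩
  refine twist_mem_selmerGroup_of_rawRows E S Q h h2S h12 h23 hgood hN hQ hQS hQ4 hk hiso8 hisoS hadm hε hp₀S hp₀Q hp8 hsplitp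
    hres₀ hd _ _ hA₁ hA₂ (γ₁ := γ₁) (γ₂ := γ₂) (c₁ := c₁) (c₂ := c₂) (ρ₁ := ρ₁) (ρ₂ := ρ₂) (s₁ := s₁) (s₂ := s₂)
    hrel (fun ℓ hℓ hℓS hℓQ hℓp => ?_) (fun j hj hjp => ?_) ?_ ?_ hrows hPa hPb hinf
  · -- parities off `S ∪ Q ∪ {p₀}`
    haveI : Fact ℓ.Prime := ⟨hℓ⟩
    obtain ⟨b1, b2⟩ := hBpar ℓ hℓ hℓS
    obtain ⟨x1, x2⟩ := hXpar ℓ hℓ hℓp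
    obtain ⟨q1, q2⟩ := hparP ℓ
    rw [Units.val_mul, Units.val_mul, Units.val_mul, Units.val_mul, Units.val_mk0, Units.val_mk0,
      parityBit_mul (mul_ne_zero B₁.ne_zero hp₁) X₁.ne_zero, parityBit_mul B₁.ne_zero hp₁,
      parityBit_mul (mul_ne_zero B₂.ne_zero hp₂) X₂.ne_zero, parityBit_mul B₂.ne_zero hp₂, b1, b2, x1, x2, q1, q2,
      if_neg (fun e => hℓQ (hA₁ e)), if_neg (fun e => hℓQ (hA₂ e))]
    simp
  · -- bits at `j ∈ Q`
    haveI : Fact j.Prime := ⟨hjp⟩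
    have hjS : j ∉ S := hQS j hj
    have hjp₀ : j ≠ p₀ := fun e => hp₀Q (e ▸ hj)
    obtain ⟨b1, b2⟩ := hBpar j hjp hjS
    obtain ⟨x1, x2⟩ := hXpar j hjp hjp₀
    obtain ⟨q1, q2⟩ := hparP j
    obtain ⟨r1, r2⟩ := hBQ j hj hjp
    obtain ⟨y1, y2⟩ := hXQ j hj hjp
    simp only [Units.val_mul, Units.val_mk0]
    rw [parityBit_mul (mul_ne_zero B₁.ne_zero hp₁) X₁.ne_zero, parityBit_mul B₁.ne_zero hp₁,
      parityBit_mul (mul_ne_zero B₂.ne_zero hp₂) X₂.ne_zero, parityBit_mul B₂.ne_zero hp₂,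
      qrBit_mul j (mul_ne_zero B₁.ne_zero hp₁) X₁.ne_zero, qrBit_mul j B₁.ne_zero hp₁,
      qrBit_mul j (mul_ne_zero B₂.ne_zero hp₂) X₂.ne_zero, qrBit_mul j B₂.ne_zero hp₂, b1, b2, x1, x2, q1, q2, r1, r2, y1, y2]
    refine ⟨by simp, by simp, by ring, by ring⟩
  · -- bits at `p₀`
    obtain ⟨b1, b2⟩ := hBpar p₀ hp₀.out hp₀S
    obtain ⟨q1, q2⟩ := hparP p₀
    simp only [Units.val_mul, Units.val_mk0]
    rw [parityBit_mul (mul_ne_zero B₁.ne_zero hp₁) X₁.ne_zero, parityBit_mul B₁.ne_zero hp₁,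
      parityBit_mul (mul_ne_zero B₂.ne_zero hp₂) X₂.ne_zero, parityBit_mul B₂.ne_zero hp₂,
      qrBit_mul p₀ (mul_ne_zero B₁.ne_zero hp₁) X₁.ne_zero, qrBit_mul p₀ B₁.ne_zero hp₁,
      qrBit_mul p₀ (mul_ne_zero B₂.ne_zero hp₂) X₂.ne_zero, qrBit_mul p₀ B₂.ne_zero hp₂, b1, b2, q1, q2,
      if_neg (fun e => hp₀Q (hA₁ e)), if_neg (fun e => hp₀Q (hA₂ e)), hXp.1, hXp.2, hBp.1, hBp.2, hqP.1, hqP.2, hXp₀.1, hXp₀.2]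
    refine ⟨by simp, by simp, by ring, by ring⟩
  · -- signs
    simp only [Units.val_mul, Units.val_mk0]
    rw [signBit_mul (mul_ne_zero B₁.ne_zero hp₁) X₁.ne_zero, signBit_mul B₁.ne_zero hp₁,
      signBit_mul (mul_ne_zero B₂.ne_zero hp₂) X₂.ne_zero, signBit_mul B₂.ne_zero hp₂, hBs.1, hBs.2, hsP₁, hsP₂, hXs.1, hXs.2]
    exact ⟨by ring, by ring⟩

end Summit.BirchSwinnertonDyer.BirchSwinnertonDyer.Theorems.GenusKolyvaginAtTwo.TorsionCellSEL

end
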